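import Summits.ABC.ABC.Theorems.EisensteinQuarantine.Negative.EisensteinQuarantineFalseOfForcedPairOccurrence
import HarnessLib

/-!
# `EisensteinQuarantine` (stmt-ABC-15023, route ABC/DefiniteXi) is false under the forced-pair DEPTH LAW alone
# — the hypothesis-minimal form of line `forced-pair-dlog`, and why every refutation passes through the eigen-line

Negative lemma filed `--negative-modulo ForcedPairDepthLaw` by the lead (c2) of crux line `forced-pair-dlog`
(2026-08-17).  The sibling file `EisensteinQuarantineFalseOfForcedPairOccurrence` (p133187) refutes the crux from
THREE displayed inputs — `takahashi2001_brandtEigenLattice_rank_one` (Jacquet–Langlands + multiplicity one),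
`FreyModularity`, and the vector-form research statement `ForcedPairOccurrence`.  This file records two facts
about the line's floor:

* `EisensteinQuarantine_false_of_ForcedPairDepthLaw` — the VALUATION form of the law,
  `ForcedPairDepthLaw : ∃ c, ∀ primes q ≠ 2, ℓ, 32 q ∣ ℓ − 1 ⟹ 2^{v₂(q−1)} ≤ 2^c · ordProj[2] ξ(E_(−ℓ,ℓ−1); N/ℓ, ℓ)`,
  ALONE refutes the crux: no Jacquet–Langlands, no modularity and no Linnik hypothesis is displayed (the prime
  supply is the tree's theorem `PrimesInAPGallagher.exists_primes_two_pow_mul_dvd_sub_one`, p132885).  This is the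
  statement the censuses measure row by row (`v₂ ξ ≥ class-min v₂ deg − 1` by Takahashi at the quarantined prime;
  direct Brandt `ξ` where `h ≤ 12300`): kit j019358/j019359/j019456/j019482/j019719 (forced levels `q = 17, 97, 193`,
  first in-scope pair `(17, 5441)`: `v₂ ξ ≥ 13 ≥ v₂ 16 − c`), consistent with `c = 2` on every computed row.
* `isLine_of_forcedPairDepthLaw` / `frequently_isLine_of_forcedPairDepthLaw` — the law is JUNK-SENSITIVE in
  exactly one way: at every pair `(q, ℓ)` with `v₂(q−1) > c` it forces the `a(E)`-eigen-lattice of the Brandt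
  matrices to be a LINE `ℤ φ` in EVERY Brandt setup of type `(N/ℓ, ℓ)` (off a line `S.xi = 0` and
  `ordProj[2] 0 = 1 < 2^{v₂(q−1) − c}`), and by the proved two-prime supply such pairs exist with `v₂(q−1)`
  unbounded.  So any proof of the law — indeed any lower bound on `ordProj[2] ξ` along an infinite family, which is
  what every refutation of this crux must produce — contains the eigen-line statement (Eichler's basis problem /
  Jacquet–Langlands existence + strong multiplicity one) on an infinite family of Frey curves: the content of the
  named fact `Literature.NumberTheory.EllipticCurves.takahashi2001_brandtEigenLattice_rank_one`.  This is the
  kernel-checked form of "the crux item is blocked on rank one in the negative direction" (it is census-false in the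
  positive one).
* `forcedPairDepthLaw_of_forcedPairOccurrence` — conversely rank one + modularity + the vector-form occurrence give
  the law (the glue `forcedPairDepthLaw_of_occurrence`, p133187, repackaged), so the two negative lemmas agree.

## References

* [Mazur1977] B. Mazur, *Modular curves and the Eisenstein ideal*, Publ. Math. IHÉS 47 (1977), II.16.6, II.18.10.
* [Takahashi2001] S. Takahashi, J. Number Theory 90 (2001), §2 p. 78, Thm. 2.3.
* [Gallagher1970] P. X. Gallagher, Invent. Math. 11 (1970), Theorem 7.
* [PollackWeston2011] R. Pollack, T. Weston, Compos. Math. 147 (2011), §2.1.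
-/

-- `Summit.<Summit>.<Problem>`: for the single-conjunct summit `ABC` the duplicate `ABC.ABC` is mandated.
set_option linter.dupNamespace false

noncomputable section

open scoped BigOperators
open Literature.NumberTheory.Automorphic Literature.NumberTheory.EllipticCurves

namespace Summit.ABC.ABC.Theorems.EisensteinQuarantine.Negative

/-! ## The hypothesis: the forced-pair depth law (valuation form) -/

/-- **Hypothesis `ForcedPairDepthLaw` — the forced-pair 2-adic depth law, valuation form (census-backed, NOT
proved, NOT in print).**  There is `c` such that for all primes `q ≠ 2` and `ℓ` with `32 q ∣ ℓ − 1` (the pair is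
FORCED: `ℓ ≡ 1 (mod q)`, so `ℓ` is a `2^j`-th power residue modulo `q` to every depth `j`), for the Frey curve
`E = E_(−ℓ, ℓ−1)` of the triple `1 + (ℓ−1) = ℓ` with conductor `N` (`= rad(ℓ(ℓ−1))`):
`2^{v₂(q−1)} ≤ 2^c · ordProj[2] ξ(E; N/ℓ, ℓ)`, `ξ = brandtXi (N/ℓ) ℓ (a(E))` — the unquarantined level prime `q`
realises (up to `c`) the 2-part of its Eisenstein index in the quarantined congruence number.  Candidate mechanism:
Mazur's level-`q` 2-Eisenstein tower (index `num((q−1)/12) ∋ 2^{v₂(q−1)−2}`) level-raised through `ℓ` into the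
`ℓ`-new definite space; nothing in print at `p = 2` and composite squarefree level.  Census: forced levels
`q = 17, 97, 193` ↦ `v₂ ξ ≥ 4, 7, 6 ≥ v₂(q−1) − 2`; `(17, 5441)` ↦ `v₂ ξ ≥ 13`; dual gating confirmed on designed rows
(kit j019312: a level prime `q` realises `v₂(q²−1)` exactly when the quarantined prime is a deep 2-power residue mod `q`,
automatic here).  It is implied by rank one + modularity + `ForcedPairOccurrence`
(`forcedPairDepthLaw_of_forcedPairOccurrence`) and it implies the eigen-line on its family
(`isLine_of_forcedPairDepthLaw`).  HYPOTHESIS of this negative lemma (filed `--negative-modulo ForcedPairDepthLaw`);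
not a Literature fact. -/
def ForcedPairDepthLaw : Prop :=
  ∃ c : ℕ, ∀ q ℓ : ℕ, q.Prime → ℓ.Prime → q ≠ 2 → 32 * q ∣ ℓ - 1 →
    ∀ N : ℕ, (freyCurve (-(ℓ : ℤ)) ((ℓ - 1 : ℕ) : ℤ)).conductorNorm ℤ = N →
      2 ^ ((q - 1).factorization 2) ≤
        2 ^ c * ordProj[2] (brandtXi (N / ℓ) ℓ
          (fun n => (freyCurve (-(ℓ : ℤ)) ((ℓ - 1 : ℕ) : ℤ)).LFunction n))

/-! ## The refutation modulo the law alone -/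

/-- **`EisensteinQuarantine` is false under the forced-pair depth law — and nothing else.**  The two-prime 2-power
supply (`2^s ∣ q − 1`, `2^s q ∣ ℓ − 1`, `ℓ ≤ 2^{As}`) is the tree's unconditional theorem
`exists_primes_two_pow_mul_dvd_sub_one` (Gallagher's prime number theorem off one exceptional modulus + Page + no
primitive quadratic character of 2-power conductor `≥ 16`); with the law it gives `ProthDepthFamily`
(`prothDepthFamily_of_forcedPairDepthLaw`, p133187), and the landed kill `EisensteinQuarantine_false_of_ProthDepthFamily`
(p107816: at `ε = 1/(4A)`, `Nm = ℓ`, the allowance `𝓛 = ∏_{r ∣ ℓ−1} 2 v_r(ℓ−1) − …` is polynomial in `s` while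
`ordProj[2] ξ ≥ 2^{s−c}`) does the rest. [cite: Gallagher1970, Theorem 7] -/
theorem EisensteinQuarantine_false_of_ForcedPairDepthLaw (h : ForcedPairDepthLaw) :
    ¬ Summit.ABC.ABC.Theses.DefiniteXi.EisensteinQuarantine :=
  EisensteinQuarantine_false_of_ProthDepthFamily
    (prothDepthFamily_of_forcedPairDepthLaw
      Literature.NumberTheory.Sieve.PrimesInAPGallagher.exists_primes_two_pow_mul_dvd_sub_one h)

/-- **Rank one + modularity + the vector-form occurrence ⟹ the valuation-form law** (the glue
`forcedPairDepthLaw_of_occurrence` of p133187 with the eigen-line supplied by the landed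
`freyEigenLinePrime_of_rankOne_of_freyModularity`, p132391): the sibling negative lemma factors through this one.
[cite: Takahashi2001, §2 p. 78] -/
theorem forcedPairDepthLaw_of_forcedPairOccurrence
    (hR : Literature.NumberTheory.EllipticCurves.takahashi2001_brandtEigenLattice_rank_one)
    (hM : Summit.ABC.ABC.Theses.DefiniteXi.FreyModularity) (hO : ForcedPairOccurrence) :
    ForcedPairDepthLaw :=
  forcedPairDepthLaw_of_occurrence
    (Summit.ABC.ABC.Theorems.freyEigenLinePrime_of_rankOne_of_freyModularity hR hM) hO

/-! ## Junk-sensitivity: the law forces the eigen-line on its family -/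

/-- **Off a line the setup value `ξ_S` vanishes**: if the `λ`-eigen-lattice of the Brandt matrices of a setup `S`
of type `(N⁺, N⁻)` is not a line `ℤ φ`, `φ ≠ 0`, then `S.xi λ = 0` (the junk value of `Brandt.xi`), hence
`brandtXi N⁺ N⁻ λ = 0` (setup independence `Brandt.XiSetup.brandtXi_eq_xi`) and `ordProj[2] (brandtXi N⁺ N⁻ λ) = 1`.
[folklore] -/
theorem brandtXi_eq_zero_of_not_isLine {Nplus Nminus : ℕ} (S : Brandt.XiSetup Nplus Nminus)
    [Fintype (Brandt.ClassSet S.O)] (lam : ℕ → ℤ)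
    (h : ¬ ∃ φ : Brandt.ClassSet S.O → ℤ, φ ≠ 0 ∧
      Brandt.eigenLattice (Nplus * Nminus) (Brandt.matrix S.O) lam = ℤ ∙ φ) :
    brandtXi Nplus Nminus lam = 0 := by
  rw [S.brandtXi_eq_xi, Brandt.XiSetup.xi, Brandt.xiOfOrder_eq]
  exact Brandt.xi_of_not_isLine _ h

/-- **The forced-pair depth law forces the Frey eigen-lattice to be a line** at every forced pair `(q, ℓ)` beyond
its constant (`c < v₂(q−1)`), in EVERY Brandt setup of type `(N/ℓ, ℓ)`: otherwise `ξ = 0`, `ordProj[2] 0 = 1` and the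
law would read `2^{v₂(q−1)} ≤ 2^c`.  So the law contains instances of the registered stub `stub_freyEigenLinePrime`
(Eichler's basis problem / Jacquet–Langlands existence + strong multiplicity one for `f_E`, the content of the named
fact `takahashi2001_brandtEigenLattice_rank_one`) — the one way in which a LOWER bound on `ξ` is junk-sensitive.
[folklore] -/
theorem isLine_of_forcedPairDepthLaw (h : ForcedPairDepthLaw) :
    ∃ c : ℕ, ∀ q ℓ : ℕ, q.Prime → ℓ.Prime → q ≠ 2 → 32 * q ∣ ℓ - 1 → c < (q - 1).factorization 2 →
      ∀ N : ℕ, (freyCurve (-(ℓ : ℤ)) ((ℓ - 1 : ℕ) : ℤ)).conductorNorm ℤ = N →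
      ∀ (S : Brandt.XiSetup (N / ℓ) ℓ) [Fintype (Brandt.ClassSet S.O)],
        ∃ φ : Brandt.ClassSet S.O → ℤ, φ ≠ 0 ∧
          Brandt.eigenLattice (N / ℓ * ℓ) (Brandt.matrix S.O)
            (fun n => (freyCurve (-(ℓ : ℤ)) ((ℓ - 1 : ℕ) : ℤ)).LFunction n) = ℤ ∙ φ := by
  obtain ⟨c, hc⟩ := h
  refine ⟨c, fun q ℓ hq hℓ hq2 h32 hcv N hN S _ => ?_⟩
  by_contra hline
  have h0 := brandtXi_eq_zero_of_not_isLine S _ hline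
  have hle := hc q ℓ hq hℓ hq2 h32 N hN
  rw [h0, Nat.factorization_zero, Finsupp.zero_apply, pow_zero, mul_one] at hle
  exact absurd (Nat.pow_lt_pow_right (by norm_num) hcv) (not_lt.mpr hle)

/-- **… on an unbounded family.**  With the tree's two-prime 2-power supply (`exists_primes_two_pow_mul_dvd_sub_one`:
for all large `s`, primes `q`, `ℓ` with `2^s ∣ q − 1`, `2^s q ∣ ℓ − 1`, `ℓ ≤ 2^{As}`), the forced-pair depth law yields,
for every `s₀`, a forced pair `(q, ℓ)` with `v₂(q−1) ≥ s ≥ s₀` at which the Frey eigen-lattice of `E_(−ℓ,ℓ−1)` is a line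
in every setup of type `(N/ℓ, ℓ)`.  Any proof of the law therefore proves the eigen-line statement (Jacquet–Langlands
existence + multiplicity one) for infinitely many Frey curves. [cite: Gallagher1970, Theorem 7] -/
theorem frequently_isLine_of_forcedPairDepthLaw (h : ForcedPairDepthLaw) :
    ∀ s₀ : ℕ, ∃ s q ℓ : ℕ, s₀ ≤ s ∧ q.Prime ∧ ℓ.Prime ∧ q ≠ 2 ∧ 2 ^ s ∣ q - 1 ∧ 32 * q ∣ ℓ - 1 ∧
      ∀ N : ℕ, (freyCurve (-(ℓ : ℤ)) ((ℓ - 1 : ℕ) : ℤ)).conductorNorm ℤ = N →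
      ∀ (S : Brandt.XiSetup (N / ℓ) ℓ) [Fintype (Brandt.ClassSet S.O)],
        ∃ φ : Brandt.ClassSet S.O → ℤ, φ ≠ 0 ∧
          Brandt.eigenLattice (N / ℓ * ℓ) (Brandt.matrix S.O)
            (fun n => (freyCurve (-(ℓ : ℤ)) ((ℓ - 1 : ℕ) : ℤ)).LFunction n) = ℤ ∙ φ := by
  obtain ⟨c, hc⟩ := isLine_of_forcedPairDepthLaw h
  obtain ⟨A, s₁, hAs⟩ :=
    Literature.NumberTheory.Sieve.PrimesInAPGallagher.exists_primes_two_pow_mul_dvd_sub_one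
  intro s₀
  set s : ℕ := max (max s₀ (c + 1)) (max s₁ 5) with hs
  have hs5 : 5 ≤ s := (le_max_right _ _).trans (le_max_right _ _)
  have hs₁ : s₁ ≤ s := (le_max_left _ _).trans (le_max_right _ _)
  have hs₀ : s₀ ≤ s := (le_max_left _ _).trans (le_max_left _ _)
  have hsc : c + 1 ≤ s := (le_max_right _ _).trans (le_max_left _ _)
  have h32s : (32 : ℕ) ∣ 2 ^ s := by
    rw [show (32 : ℕ) = 2 ^ 5 by norm_num]; exact Nat.pow_dvd_pow 2 hs5
  obtain ⟨q, ℓ, hq, hℓ, hsq, hsl, -⟩ := hAs s hs₁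
  have hq2 : q ≠ 2 := by
    intro h2
    rw [h2] at hsq
    have := Nat.le_of_dvd (by norm_num) (h32s.trans hsq)
    omega
  have h32q : 32 * q ∣ ℓ - 1 := (Nat.mul_dvd_mul_right h32s q).trans hsl
  have hqm1 : q - 1 ≠ 0 := by have := hq.two_le; omega
  have hsv : s ≤ (q - 1).factorization 2 := (Nat.prime_two.pow_dvd_iff_le_factorization hqm1).mp hsq
  exact ⟨s, q, ℓ, hs₀, hq, hℓ, hq2, hsq, h32q,
    fun N hN S _ => hc q ℓ hq hℓ hq2 h32q (by omega) N hN S⟩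

end Summit.ABC.ABC.Theorems.EisensteinQuarantine.Negative

end
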